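import Summits.CriticalPhenomena.PercolationContinuityZ3.Theorems.Transplant.FKConnectivityAllQAntipodalTwoSpineCheck
import HarnessLib

/-!
# Two-spine word model of `U¹¹` — WEIGHTED resolutions (pieces may share nodes, with nonnegative polynomial weights)

Theorem file (`--supports stmt-CriticalPhenomena-4575`), FK sub-lane `prim-bschramm-fk-2` (gen 15); builds on p205010 (kernel
theorem, internal audit signed; external expert review pending).  No named facts, no sorries.

The node-partition resolutions of `…TwoSpineResolve` / `…TwoSpineCheck` are the special case `λ_j = 1` of a WEIGHTED resolution:
member sub-diagrams `P_j` embedded in the peeled diagram by node maps `f_j` (labels matching up to an offset, order constraints justified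
by paths) and weights `λ_j(q) ≥ 0` in Bernstein form with `∑_{j : n ∈ f_j} λ_j = d` (a positive integer) for EVERY node `n` — then
`d · dsum(E) = ∑_j λ_j · q^{c_j} · dsum(P_j)` and the statement of `E` follows from those of the pieces (`FK.TwoSpine.DStmt.of_wresolution`).
This is the diagram-level form of the `q·U + (1-q)·X2`-type splittings (memo g15 §9 (i)).  `FK.TwoSpine.WCert`, `WCert.check`,
**`WCert.sound_of_baseAll`**.
[cite: Grimmett2006, §3.8 (pp. 61–62)]
-/

noncomputable section

namespace Summit.CriticalPhenomena.PercolationContinuityZ3.Theorems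

namespace FK

namespace TwoSpine

open X2Word

/-- A WEIGHTED piece: family index, node map, exponent offset, paths for the order constraints, and a Bernstein-form weight. [folklore] -/
structure WPiece where
  /-- index of the sub-diagram in the family -/
  idx : ℕ
  /-- node map -/
  f : List ℕ
  /-- exponent offset -/
  c : ℕ
  /-- paths justifying the sub-diagram's order constraints -/
  paths : List (List ℕ)
  /-- the weight `λ` (Bernstein form, nonnegative on `[0,1]`) -/
  lam : BForm

/-- **Weighted resolution CHECK** of the diagram `E` against the family `fam`: piece data as in `Resolution.checkP` (index range, length,
label/offset match, node indices in range, no repeated node inside a piece, paths), a positive integer `d`, and for every node `n` of `E`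
the polynomial identity `∑_{j : n ∈ f_j} λ_j = d`. [folklore] -/
def Resolution.checkW (fam : List Diagram) (E : Diagram) (d : ℕ) (pieces : List WPiece) : Bool :=
  decide (0 < d) &&
  (pieces.all fun wp =>
    let P := fam.getD wp.idx dfltDiagram
    decide (wp.idx < fam.length) &&
    decide (wp.f.length = P.nodes.length) &&
    decide wp.f.Nodup &&
    wp.f.all (fun n => decide (n < E.nodes.length)) &&
    (List.range P.nodes.length).all (fun a =>
      decide (E.nodes.getD (wp.f.getD a 0) dfltNode = ((P.nodes.getD a dfltNode).1, (P.nodes.getD a dfltNode).2 + wp.c))) &&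
    (List.range P.le.length).all fun t =>
      isPath E.le (wp.f.getD (P.le.getD t (0, 0)).1 0) (wp.paths.getD t []) (wp.f.getD (P.le.getD t (0, 0)).2 0)) &&
  (List.range E.nodes.length).all fun n =>
    pIsZero (padd (psum ((pieces.filter fun wp => decide (n ∈ wp.f)).map fun wp => wp.lam.poly)) (pneg [(d : ℤ)]))

/-- Sum of the weights of the pieces covering node `n`. [folklore] -/
def coverWeight (q : ℝ) (pieces : List WPiece) (n : ℕ) : ℝ :=
  ((pieces.filter fun wp => decide (n ∈ wp.f)).map fun wp => wp.lam.val q).sum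

/-- The node identity of the check: `∑_{j : n ∈ f_j} λ_j(q) = d`. [folklore] -/
theorem coverWeight_eq_of_check (q : ℝ) {pieces : List WPiece} {n : ℕ} {d : ℕ}
    (h : pIsZero (padd (psum ((pieces.filter fun wp => decide (n ∈ wp.f)).map fun wp => wp.lam.poly)) (pneg [(d : ℤ)])) = true) :
    coverWeight q pieces n = d := by
  have h0 := peval_eq_zero_of_pIsZero q h
  rw [peval_padd, peval_psum, peval_pneg, List.map_map] at h0
  simp only [peval, Int.cast_natCast, mul_zero, add_zero] at h0
  unfold coverWeight BForm.val
  have : ((pieces.filter fun wp => decide (n ∈ wp.f)).map fun wp => peval q wp.lam.poly) =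
      ((pieces.filter fun wp => decide (n ∈ wp.f)).map (peval q ∘ fun wp => wp.lam.poly)) := rfl
  rw [this]; linarith

/-- A piece's node term sum: `∑_{n ∈ f} F(n) = ∑_{n < L} 1{n ∈ f} F(n)` for a duplicate-free `f` with entries `< L`. [folklore] -/
theorem sum_map_eq_sum_range_indicator (L : ℕ) (f : List ℕ) (hf : f.Nodup) (hlt : ∀ n ∈ f, n < L) (F : ℕ → ℝ) :
    (f.map F).sum = ∑ n ∈ Finset.range L, (if n ∈ f then F n else 0) := by
  rw [← List.sum_toFinset _ hf, ← Finset.sum_filter]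
  congr 1
  ext n
  simp only [List.mem_toFinset, Finset.mem_filter, Finset.mem_range]
  exact ⟨fun h => ⟨hlt n h, h⟩, fun h => h.2⟩

/-- `coverWeight` of a `cons`. [folklore] -/
theorem coverWeight_cons (q : ℝ) (wp : WPiece) (ps : List WPiece) (n : ℕ) :
    coverWeight q (wp :: ps) n = (if n ∈ wp.f then wp.lam.val q else 0) + coverWeight q ps n := by
  unfold coverWeight
  rw [List.filter_cons]
  by_cases h : n ∈ wp.f <;> simp [h]

/-- Swapping the double sum: `∑_n (∑_{j ∋ n} λ_j) F(n) = ∑_j λ_j ∑_{n ∈ f_j} F(n)`. [folklore] -/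
theorem sum_coverWeight_mul (q : ℝ) (L : ℕ) (F : ℕ → ℝ) (pieces : List WPiece)
    (h : ∀ wp ∈ pieces, wp.f.Nodup ∧ ∀ n ∈ wp.f, n < L) :
    ∑ n ∈ Finset.range L, coverWeight q pieces n * F n = (pieces.map fun wp => wp.lam.val q * (wp.f.map F).sum).sum := by
  induction pieces with
  | nil => simp [coverWeight]
  | cons wp ps ih =>
    obtain ⟨hnd, hlt⟩ := h wp List.mem_cons_self
    rw [List.map_cons, List.sum_cons, ← ih (fun x hx => h x (List.mem_cons_of_mem _ hx)),
      sum_map_eq_sum_range_indicator L wp.f hnd hlt, Finset.mul_sum, ← Finset.sum_add_distrib]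
    refine Finset.sum_congr rfl fun n _ => ?_
    rw [coverWeight_cons]
    by_cases hmem : n ∈ wp.f
    · simp [hmem, add_mul]
    · simp [hmem]

/-- **WEIGHTED RESOLUTION SOUNDNESS**: a checked weighted resolution reduces the statement of `E` to those of its pieces (`0 ≤ q ≤ 1`). [folklore] -/
theorem DStmt.of_wresolution {q : ℝ} (hq0 : 0 ≤ q) (hq1 : q ≤ 1) {top : Top} {fam : List Diagram} {E : Diagram} {d : ℕ} {pieces : List WPiece}
    (hc : Resolution.checkW fam E d pieces = true) {oA oB : List Kind}
    (hP : ∀ wp ∈ pieces, DStmt q top (fam.getD wp.idx dfltDiagram) oA oB) : DStmt q top E oA oB := by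
  intro S hS
  unfold Resolution.checkW at hc
  simp only [Bool.and_eq_true, decide_eq_true_eq, List.all_eq_true, List.mem_range] at hc
  obtain ⟨⟨hd, hpc⟩, hnode⟩ := hc
  have hdpos : (0 : ℝ) < d := by exact_mod_cast hd
  -- d · dsum E = ∑_n coverWeight n · nodeTerm n
  have h1 : (d : ℝ) * dsum q top E oA oB S = ∑ n ∈ Finset.range E.nodes.length, coverWeight q pieces n * nodeTerm q top E oA oB S n := by
    rw [dsum_eq, Finset.mul_sum]
    refine Finset.sum_congr rfl fun n hn => ?_
    rw [Finset.mem_range] at hn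
    rw [coverWeight_eq_of_check q (hnode n hn)]
    rfl
  -- ∑_n coverWeight n · F n = ∑_j λ_j · ∑_{n ∈ f_j} F n
  have h2 := sum_coverWeight_mul q E.nodes.length (nodeTerm q top E oA oB S) pieces (fun wp hwp => by
    obtain ⟨⟨⟨⟨⟨-, -⟩, hnd⟩, hlt⟩, -⟩, -⟩ := hpc wp hwp
    exact ⟨hnd, hlt⟩)
  -- each piece: ∑_{n ∈ f_j} F n = q^{c_j} dsum P_j (S ∘ f_j) ≥ 0
  have h3 : ∀ wp ∈ pieces, 0 ≤ wp.lam.val q * (wp.f.map (nodeTerm q top E oA oB S)).sum := by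
    intro wp hwp
    obtain ⟨⟨⟨⟨⟨-, hlen⟩, -⟩, -⟩, hlab⟩, hle⟩ := hpc wp hwp
    have key := dsum_piece q top E oA oB S ⟨fam.getD wp.idx dfltDiagram, wp.f, wp.c⟩ hlen hlab
    rw [show wp.f = (⟨fam.getD wp.idx dfltDiagram, wp.f, wp.c⟩ : Piece).f from rfl, key]
    refine mul_nonneg (BForm.val_nonneg hq0 hq1 _) (mul_nonneg (pow_nonneg hq0 _) (hP wp hwp _ ?_))
    exact
      { nonneg := fun _ _ _ => hS.nonneg _ _ _
        monoA := fun _ _ _ _ h => hS.monoA _ _ _ _ h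
        monoB := fun _ _ _ _ h => hS.monoB _ _ _ _ h
        le := fun ab hab u v => by
          obtain ⟨t, ht, rfl⟩ := (mem_iff_getD _ (0, 0) ab).1 hab
          exact hS.le_of_isPath _ _ _ (hle t ht) u v }
  have h4 : 0 ≤ (d : ℝ) * dsum q top E oA oB S := by
    rw [h1, h2]
    exact List.sum_nonneg (fun x hx => by
      rw [List.mem_map] at hx
      obtain ⟨wp, hwp, rfl⟩ := hx
      exact h3 wp hwp)
  exact (mul_nonneg_iff_of_pos_left hdpos).1 h4

/-! ### Weighted certificates -/

/-- A closure certificate with weighted resolutions: per member and op kind, `(d, pieces)` for the `A`- and the `B`-peeling. [folklore] -/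
structure WCert where
  /-- the family -/
  family : List Diagram
  /-- `resA[d][0/1]` resolves `(family[d]).peelA W/P` -/
  resA : List (List (ℕ × List WPiece))
  /-- `resB[d][0/1]` resolves `(family[d]).peelB W/P` -/
  resB : List (List (ℕ × List WPiece))

/-- The resolution of `family[i]` peeled on side `A` by kind `k`. [folklore] -/
def WCert.getA (C : WCert) (i : ℕ) (k : Kind) : ℕ × List WPiece := (C.resA.getD i []).getD (kindIdx k) (1, [])
/-- The resolution of `family[i]` peeled on side `B` by kind `k`. [folklore] -/
def WCert.getB (C : WCert) (i : ℕ) (k : Kind) : ℕ × List WPiece := (C.resB.getD i []).getD (kindIdx k) (1, [])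

/-- The decidable CHECK of a weighted closure certificate. [folklore] -/
def WCert.check (C : WCert) : Bool :=
  (List.range C.family.length).all fun i =>
    [Kind.W, Kind.P].all fun k =>
      Resolution.checkW C.family ((C.family.getD i dfltDiagram).peelA k) (C.getA i k).1 (C.getA i k).2 &&
      Resolution.checkW C.family ((C.family.getD i dfltDiagram).peelB k) (C.getB i k).1 (C.getB i k).2

/-- **SOUNDNESS of weighted closure certificates** (`0 ≤ q ≤ 1`). [folklore] -/
theorem WCert.sound {q : ℝ} (hq0 : 0 ≤ q) (hq1 : q ≤ 1) (top : Top) (C : WCert) (hc : C.check = true)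
    (hbase : ∀ D ∈ C.family, DStmt q top D [] []) : ∀ D ∈ C.family, ∀ oA oB : List Kind, DStmt q top D oA oB := by
  have hcheck : ∀ i < C.family.length, ∀ k : Kind,
      Resolution.checkW C.family ((C.family.getD i dfltDiagram).peelA k) (C.getA i k).1 (C.getA i k).2 = true ∧
      Resolution.checkW C.family ((C.family.getD i dfltDiagram).peelB k) (C.getB i k).1 (C.getB i k).2 = true := by
    intro i hi k
    unfold WCert.check at hc
    simp only [List.all_eq_true, List.mem_range, Bool.and_eq_true] at hc
    have hk : k ∈ [Kind.W, Kind.P] := by cases k <;> simp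
    exact hc i hi k hk
  have hmem : ∀ wp : WPiece, wp.idx < C.family.length → C.family.getD wp.idx dfltDiagram ∈ C.family :=
    fun wp h => (mem_iff_getD C.family dfltDiagram _).2 ⟨wp.idx, h, rfl⟩
  have hidx : ∀ {E : Diagram} {d : ℕ} {pieces : List WPiece}, Resolution.checkW C.family E d pieces = true →
      ∀ wp ∈ pieces, wp.idx < C.family.length := by
    intro E d pieces h wp hwp
    unfold Resolution.checkW at h
    simp only [Bool.and_eq_true, decide_eq_true_eq, List.all_eq_true] at h
    exact (h.1.2 wp hwp).1.1.1.1.1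
  have hB : ∀ oB : List Kind, ∀ D ∈ C.family, DStmt q top D [] oB := by
    intro oB
    induction oB using List.reverseRecOn with
    | nil => exact hbase
    | append_singleton oB k ih =>
      intro D hD
      obtain ⟨i, hi, rfl⟩ := (mem_iff_getD C.family dfltDiagram D).1 hD
      have hres := (hcheck i hi k).2
      exact DStmt.of_peelB (DStmt.of_wresolution hq0 hq1 hres fun wp hwp => ih _ (hmem wp (hidx hres wp hwp)))
  intro D hD oA
  induction oA using List.reverseRecOn generalizing D with
  | nil => exact fun oB => hB oB D hD
  | append_singleton oA k ih =>
    intro oB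
    obtain ⟨i, hi, rfl⟩ := (mem_iff_getD C.family dfltDiagram D).1 hD
    have hres := (hcheck i hi k).1
    exact DStmt.of_peelA (DStmt.of_wresolution hq0 hq1 hres fun wp hwp => ih _ (hmem wp (hidx hres wp hwp)) oB)

/-- **THE MODE INDUCTION with weighted resolutions**: checked closure + checked base certificates ⇒ every member, all shapes. [folklore] -/
theorem WCert.sound_of_baseAll {q : ℝ} (hq0 : 0 ≤ q) (hq1 : q ≤ 1) (top : Top) (C : WCert) (hc : C.check = true)
    {bcs : List BaseCert} (hb : baseAll top C.family bcs = true) :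
    ∀ D ∈ C.family, ∀ oA oB : List Kind, DStmt q top D oA oB :=
  WCert.sound hq0 hq1 top C hc (DStmt.nil_nil_of_baseAll hq0 hq1 hb)

end TwoSpine

end FK

end Summit.CriticalPhenomena.PercolationContinuityZ3.Theorems

end
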